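import Mathlib
import Summits.NavierStokesRegularity.FluidComputer.AbcInertiaCIIndexSets
import Summits.NavierStokesRegularity.FluidComputer.AbcInertiaHeadForm

/-!
# INERTIA-3L instantiation — CLASS I twin (instab3 g8; cert-3 g9's `AbcClassI` layer; character-free lemmas
# reused from the class-II files `AbcInertia*`). Part 3: the HEAD of the weighted form as a pair of real quadratic forms
# (instab3 g8, cell `ns-blowup`, 2026-08-27)

HONEST FRAMING (human ruling D-0035): nothing here is a claim about Navier–Stokes blow-up.
WHAT THIS IS NOT: not NS evidence. MODEL lane (forced-ABC linearisation, class II, coordinates of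
`AbcClassIIDefs`); no certificate, number or census word moves.

For an INERTIA-3L certificate with junction head `H` (a `Finset AbcClassI.Idx` with `i ∈ H ↔ |O_i|² ≤ r_H²`), first
tail shell `B` (`r_H² < |O_i|² ≤ (r_H+1)²`) and a real symmetric HEAD WEIGHT `GH` on `H` (the weight operator
is `(G w)_i = Σ_{j ∈ H} GH i j · w_j` on `H` and `w_i` off `H`; the certificates use `GH = X ⊕ 1`), the finitely
supported part of `⟪G w, (L − a) w⟫` is
`Σ_{i ∈ H} conj((G w)_i) ((L − a) w)_i + Σ_{i ∈ B} conj(w_i) Σ_{j ∈ H} AbcClassI.amat i j w_j` (head rows + the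
`B → H` couplings of the tail rows). This file proves the purely algebraic identity (no analysis):

  `2 · Re(that) = Q(Re w_H, Re w_B) + Q(Im w_H, Im w_B)`,
  `Q(x, y) = x ⬝ (M₀ x) + 2 · x ⬝ (F₂ y)`, `M₀ = GH·Â_HH + Â_HHᵀ·GH`, `F₂ = GH·amat_HB + (amat_BH)ᵀ`,
  `Â_HH = [(−|O_i|²/R − a) δ_ij + AbcClassI.amat i j]_{i,j ∈ H}`

— the `M₀`, `F₂` of `InertiaJunctionSquare.head_boundary_form_neg` (instab3 g7, p509518) — using only
finite sums, the reality of all matrices (`Re(conj z₁ · z₂) = Re z₁ Re z₂ + Im z₁ Im z₂`) and the (R4) facts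
of `AbcInertiaIndexSets` (the `H`-rows of `L` see `H ∪ B` only). §1: generic complex-to-real identities
for real matrices; §2: the head rows of `L − a` in block form; §3: the identity.

Mathlib + `AbcInertiaIndexSets`; no new definitions; std axioms. [folklore]
-/

noncomputable section

open scoped BigOperators ComplexConjugate Matrix
open Finset Matrix

namespace Summit.NavierStokesRegularity.FluidComputer.AbcInertiaCI

open Literature.Analysis.FunctionSpaces Literature.Analysis.FunctionSpaces.Torus
open Literature.Analysis.FluidPDE
open Summit.NavierStokesRegularity.FluidComputer.AbcClassI
open Summit.NavierStokesRegularity.FluidComputer.AbcClassII (Fam crossForm secOp rotR rotS sgnAct sgnOrbit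
  cube extend restrictTo extend_add extend_smul extend_zero rotR_add rotR_smul rotS_add rotS_smul
  crossForm_add crossForm_smul secOp_add secOp_smul restrictTo_add restrictTo_smul Orbit toOrbit onormSq
  osupNorm cubeOrbits nbrOrbits mem_sgnOrbit mem_sgnOrbit_self card_sgnOrbit_le sgnOrbit_eq_of_mem
  mem_sgnOrbit_comm sgnOrbit_eq_or_disjoint neg_mem_sgnOrbit neg_self_mem_sgnOrbit rotFreqR_mem_sgnOrbit
  rotFreqS_mem_sgnOrbit freqNormSq_eq_of_mem_sgnOrbit supNorm_eq_of_mem_sgnOrbit mem_cube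
  mem_cube_iff_supNorm cube_mono sgnOrbit_subset_cube zero_not_mem_sgnOrbit ne_zero_of_mem_sgnOrbit
  toOrbit_val toOrbit_eq_iff mem_cubeOrbits mem_nbrOrbits mem_nbrOrbits_comm card_nbrOrbits_le rotR_apply
  rotS_apply freqNormSq_rotFreq secOp_conj isConjSymm_secOp kdot_secOp mem_iff_of_orbitClosed
  isConjSymm_cut kdot_cut orbitClosed_cube_ne_zero orbitClosed_shell neg_mem_of_orbitClosed
  isConjSymm_lerayCrossForm kdot_conj conj_eq_zero_of_not_mem linOp_zero_eq conj_theta_neg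
  extend_apply_of_mem extend_apply_of_not_mem restrictTo_extend extend_restrictTo extend_sum
  inner_eq_sum_extend inner_conjVec_conjVec conj_sum_inner_of_isConjSymm sum_inner_eq_re_of_isConjSymm
  real_inner_eq_re real_smul_eq norm_lerayCrossForm_le sobolevWeight_one_eq cube_filter_eq_biUnion sum_cube_filter_eq
  onormSq_nonneg)

/-! ### §1 Complex-to-real identities for real matrices -/

section RealMatrices

variable {m n : Type*} [Fintype m] [Fintype n]

end RealMatrices

/-! ### §2 The head rows of `L − a` in block form -/

section Head

variable {R a rL rH : ℝ} (h0 : 0 ≤ rL) (hLH : rL + 1 ≤ rH)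
variable {HL HH HB : Finset AbcClassI.Idx}
variable (hHL : ∀ i : AbcClassI.Idx, i ∈ HL ↔ onormSq i.1 ≤ rL ^ 2)
variable (hHH : ∀ i : AbcClassI.Idx, i ∈ HH ↔ onormSq i.1 ≤ rH ^ 2)
variable (hHB : ∀ i : AbcClassI.Idx, i ∈ HB ↔ rH ^ 2 < onormSq i.1 ∧ onormSq i.1 ≤ (rH + 1) ^ 2)

include h0 hLH hHH hHB in
/-- **The `H`-rows of the first-order matrix see `H ∪ B` only**: for `i ∈ H`,
`Σ_{j ∈ AbcClassI.nbrIdx i} AbcClassI.amat i j w_j = Σ_{j ∈ H} AbcClassI.amat i j w_j + Σ_{l ∈ B} AbcClassI.amat i l w_l`. -/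
theorem rowSum_eq_of_mem_HH (w : AbcClassI.Idx → ℂ) {i : AbcClassI.Idx} (hi : i ∈ HH) :
    ∑ j ∈ AbcClassI.nbrIdx i, ((AbcClassI.amat i j : ℝ) : ℂ) * w j =
      ∑ j ∈ HH, ((AbcClassI.amat i j : ℝ) : ℂ) * w j + ∑ l ∈ HB, ((AbcClassI.amat i l : ℝ) : ℂ) * w l := by
  classical
  rw [← Finset.sum_union (disjoint_HH_HB hHH hHB)]
  -- both sides are the sum over `AbcClassI.nbrIdx i ∩ (H ∪ B)`; the rest vanishes
  rw [← Finset.sum_filter_add_sum_filter_not (AbcClassI.nbrIdx i) (fun j => j ∈ HH ∪ HB),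
    ← Finset.sum_filter_add_sum_filter_not (HH ∪ HB) (fun j => j ∈ AbcClassI.nbrIdx i)]
  have h1 : ∑ j ∈ (AbcClassI.nbrIdx i).filter (fun j => j ∉ HH ∪ HB), ((AbcClassI.amat i j : ℝ) : ℂ) * w j = 0 := by
    refine Finset.sum_eq_zero fun j hj => ?_
    obtain ⟨hjn, hjU⟩ := Finset.mem_filter.mp hj
    exfalso; apply hjU
    by_cases hjH : j ∈ HH
    · exact Finset.mem_union_left _ hjH
    · exact Finset.mem_union_right _ (mem_HB_of_mem_nbrIdx_of_mem_HH h0 hLH hHH hHB hi hjn hjH)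
  have h2 : ∑ j ∈ (HH ∪ HB).filter (fun j => j ∉ AbcClassI.nbrIdx i), ((AbcClassI.amat i j : ℝ) : ℂ) * w j = 0 := by
    refine Finset.sum_eq_zero fun j hj => ?_
    rw [amat_eq_zero_of_not_mem (Finset.mem_filter.mp hj).2]; simp
  rw [h1, h2, add_zero, add_zero]
  refine Finset.sum_congr ?_ fun _ _ => rfl
  ext j
  simp only [Finset.mem_filter]
  tauto

/-- **Row sums against the indicator of `H` are the plain `H`-sums** (used for the `B`-rows of the
tail): `Σ_{j ∈ AbcClassI.nbrIdx i} AbcClassI.amat i j (𝟙_H w)_j = Σ_{j ∈ H} AbcClassI.amat i j w_j` (any `i`). -/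
theorem rowSum_indicator_eq (w : AbcClassI.Idx → ℂ) (i : AbcClassI.Idx) :
    ∑ j ∈ AbcClassI.nbrIdx i, ((AbcClassI.amat i j : ℝ) : ℂ) * (if j ∈ HH then w j else 0) =
      ∑ j ∈ HH, ((AbcClassI.amat i j : ℝ) : ℂ) * w j := by
  classical
  rw [← Finset.sum_filter_add_sum_filter_not (AbcClassI.nbrIdx i) (fun j => j ∈ HH),
    ← Finset.sum_filter_add_sum_filter_not HH (fun j => j ∈ AbcClassI.nbrIdx i)]
  have h1 : ∑ j ∈ (AbcClassI.nbrIdx i).filter (fun j => j ∉ HH), ((AbcClassI.amat i j : ℝ) : ℂ) * (if j ∈ HH then w j else 0) = 0 :=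
    Finset.sum_eq_zero fun j hj => by rw [if_neg (Finset.mem_filter.mp hj).2, mul_zero]
  have h2 : ∑ j ∈ HH.filter (fun j => j ∉ AbcClassI.nbrIdx i), ((AbcClassI.amat i j : ℝ) : ℂ) * w j = 0 :=
    Finset.sum_eq_zero fun j hj => by rw [amat_eq_zero_of_not_mem (Finset.mem_filter.mp hj).2]; simp
  rw [h1, h2, add_zero, add_zero]
  refine Finset.sum_congr ?_ fun j hj => by rw [if_pos (Finset.mem_filter.mp hj).1]
  ext j
  simp only [Finset.mem_filter]
  tauto

end Head

/-! ### §3 The head identity -/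

section HeadIdentity

variable {R a rL rH : ℝ} (h0 : 0 ≤ rL) (hLH : rL + 1 ≤ rH)
variable {HL HH HB : Finset AbcClassI.Idx}
variable (hHL : ∀ i : AbcClassI.Idx, i ∈ HL ↔ onormSq i.1 ≤ rL ^ 2)
variable (hHH : ∀ i : AbcClassI.Idx, i ∈ HH ↔ onormSq i.1 ≤ rH ^ 2)
variable (hHB : ∀ i : AbcClassI.Idx, i ∈ HB ↔ rH ^ 2 < onormSq i.1 ∧ onormSq i.1 ≤ (rH + 1) ^ 2)
variable (GH Ah : Matrix ↥HH ↥HH ℝ) (AHB : Matrix ↥HH ↥HB ℝ) (ABH : Matrix ↥HB ↥HH ℝ)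
variable (hGH : GHᵀ = GH)
variable (hAh : Ah = Matrix.of fun i j : ↥HH =>
  (if i = j then -(onormSq i.1.1 / R) - a else 0) + AbcClassI.amat i.1 j.1)
variable (hAHB : AHB = Matrix.of fun (i : ↥HH) (l : ↥HB) => AbcClassI.amat i.1 l.1)
variable (hABH : ABH = Matrix.of fun (l : ↥HB) (i : ↥HH) => AbcClassI.amat l.1 i.1)

include h0 hLH hHH hHB hAh hAHB in
/-- **The head rows of `(L − a) w` in block form**: for `i ∈ H`,
`((L − a) w)_i = Σ_{j : H} Â_ij w_j + Σ_{l : B} AbcClassI.amat i l · w_l`. -/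
theorem headRow_eq (w : AbcClassI.Idx → ℂ) (i : ↥HH) :
    ((-(onormSq i.1.1 / R) : ℝ) : ℂ) * w i.1 + ∑ j ∈ AbcClassI.nbrIdx i.1, ((AbcClassI.amat i.1 j : ℝ) : ℂ) * w j -
        ((a : ℝ) : ℂ) * w i.1 =
      ∑ j : ↥HH, ((Ah i j : ℝ) : ℂ) * w j.1 + ∑ l : ↥HB, ((AHB i l : ℝ) : ℂ) * w l.1 := by
  classical
  rw [rowSum_eq_of_mem_HH h0 hLH hHH hHB w i.2, hAh, hAHB]
  simp only [Matrix.of_apply]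
  rw [← Finset.sum_coe_sort HH, ← Finset.sum_coe_sort HB]
  have hdiag : ∑ j : ↥HH, (((if i = j then -(onormSq i.1.1 / R) - a else 0 : ℝ) : ℂ)) * w j.1 =
      (((-(onormSq i.1.1 / R) - a : ℝ)) : ℂ) * w i.1 := by
    rw [Finset.sum_eq_single i]
    · rw [if_pos rfl]
    · intro j _ hji; rw [if_neg (Ne.symm hji)]; simp
    · intro h; exact absurd (Finset.mem_univ i) h
  have hsplit : ∑ j : ↥HH, (((if i = j then -(onormSq i.1.1 / R) - a else 0 : ℝ) + AbcClassI.amat i.1 j.1 : ℝ) : ℂ) * w j.1 =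
      ∑ j : ↥HH, (((if i = j then -(onormSq i.1.1 / R) - a else 0 : ℝ) : ℂ)) * w j.1 +
        ∑ j : ↥HH, ((AbcClassI.amat i.1 j.1 : ℝ) : ℂ) * w j.1 := by
    rw [← Finset.sum_add_distrib]
    refine Finset.sum_congr rfl fun j _ => ?_
    push_cast; ring
  rw [hsplit, hdiag]
  push_cast
  ring

include h0 hLH hHH hHB hGH hAh hAHB hABH in
/-- **THE HEAD IDENTITY.** For every coefficient vector `w : AbcClassI.Idx → ℂ`, with
`(G w)_i = Σ_{j : H} GH i j w_j` (`i ∈ H`):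
`2 Re [Σ_{i : H} conj((G w)_i) ((L − a) w)_i + Σ_{i : B} conj(w_i) Σ_{j ∈ H} AbcClassI.amat i j w_j]`
`= Q(Re w_H, Re w_B) + Q(Im w_H, Im w_B)`, `Q(x, y) = x ⬝ (M₀ x) + 2 x ⬝ (F₂ y)`,
`M₀ = GH Â + Âᵀ GH`, `F₂ = GH amat_HB + (amat_BH)ᵀ`. -/
theorem two_mul_re_head_eq (w : AbcClassI.Idx → ℂ) :
    2 * (∑ i : ↥HH, (starRingEnd ℂ) (∑ j : ↥HH, ((GH i j : ℝ) : ℂ) * w j.1) *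
          (((-(onormSq i.1.1 / R) : ℝ) : ℂ) * w i.1 + ∑ j ∈ AbcClassI.nbrIdx i.1, ((AbcClassI.amat i.1 j : ℝ) : ℂ) * w j -
            ((a : ℝ) : ℂ) * w i.1) +
        ∑ i : ↥HB, (starRingEnd ℂ) (w i.1) * ∑ j ∈ HH, ((AbcClassI.amat i.1 j : ℝ) : ℂ) * w j).re =
      ((fun i : ↥HH => (w i.1).re) ⬝ᵥ ((GH * Ah + Ahᵀ * GH) *ᵥ fun i : ↥HH => (w i.1).re) +
          2 * ((fun i : ↥HH => (w i.1).re) ⬝ᵥ ((GH * AHB + ABHᵀ) *ᵥ fun l : ↥HB => (w l.1).re))) +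
        ((fun i : ↥HH => (w i.1).im) ⬝ᵥ ((GH * Ah + Ahᵀ * GH) *ᵥ fun i : ↥HH => (w i.1).im) +
          2 * ((fun i : ↥HH => (w i.1).im) ⬝ᵥ ((GH * AHB + ABHᵀ) *ᵥ fun l : ↥HB => (w l.1).im))) := by
  classical
  -- block form of the head rows
  have hrow : ∀ i : ↥HH, ((-(onormSq i.1.1 / R) : ℝ) : ℂ) * w i.1 +
      ∑ j ∈ AbcClassI.nbrIdx i.1, ((AbcClassI.amat i.1 j : ℝ) : ℂ) * w j - ((a : ℝ) : ℂ) * w i.1 =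
      ∑ j : ↥HH, ((Ah i j : ℝ) : ℂ) * w j.1 + ∑ l : ↥HB, ((AHB i l : ℝ) : ℂ) * w l.1 :=
    fun i => headRow_eq h0 hLH hHH hHB Ah AHB hAh hAHB w i
  simp_rw [hrow, mul_add, Finset.sum_add_distrib]
  -- move the weight across: `Σ conj(GH w_H)·(Ah w_H) = Σ conj(w_H)·(GH Ah w_H)` etc.
  rw [AbcInertia.sum_conj_weight_mul GH hGH Ah (fun j : ↥HH => w j.1) (fun j : ↥HH => w j.1),
    AbcInertia.sum_conj_weight_mul GH hGH AHB (fun j : ↥HH => w j.1) (fun l : ↥HB => w l.1)]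
  -- the `B`-rows as a Fintype sum with the matrix `ABH`
  have hB : ∑ i : ↥HB, (starRingEnd ℂ) (w i.1) * ∑ j ∈ HH, ((AbcClassI.amat i.1 j : ℝ) : ℂ) * w j =
      ∑ i : ↥HB, (starRingEnd ℂ) (w i.1) * ∑ j : ↥HH, ((ABH i j : ℝ) : ℂ) * w j.1 := by
    refine Finset.sum_congr rfl fun i _ => ?_
    rw [← Finset.sum_coe_sort HH, hABH]
    rfl
  rw [hB]
  -- real parts
  rw [Complex.add_re, Complex.add_re, mul_add, mul_add,
    AbcInertia.two_mul_re_sum_conj_mul_sum (GH * Ah) (fun j : ↥HH => w j.1),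
    AbcInertia.re_sum_conj_mul_sum (GH * AHB) (fun j : ↥HH => w j.1) (fun l : ↥HB => w l.1),
    AbcInertia.re_sum_conj_mul_sum ABH (fun i : ↥HB => w i.1) (fun j : ↥HH => w j.1)]
  -- `(GH Ah)ᵀ = Ahᵀ GH`, `x_B ⬝ (ABH x_H) = x_H ⬝ (ABHᵀ x_B)`
  have ht : (GH * Ah)ᵀ = Ahᵀ * GH := by rw [Matrix.transpose_mul, hGH]
  rw [ht, ← AbcInertia.dotProduct_transpose_mulVec ABH (fun j : ↥HH => (w j.1).re) (fun i : ↥HB => (w i.1).re),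
    ← AbcInertia.dotProduct_transpose_mulVec ABH (fun j : ↥HH => (w j.1).im) (fun i : ↥HB => (w i.1).im)]
  simp only [Matrix.add_mulVec, dotProduct_add]
  ring

end HeadIdentity

end Summit.NavierStokesRegularity.FluidComputer.AbcInertiaCI

end
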